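import Summits.AnomalousDissipation.AnomalousDissipation.Theses.ReynoldsLanding

/-!
# Glue item `ReynoldsLanding.LowModeLandingJunctionGlue` (stmt-AnomalousDissipation-30924)

Sorry-free proof of the GLUE item of route `route-AnomalousDissipation-ReynoldsLanding`: `PowerLanding → MeanFlowLanding → FluctuationLanding → RootDecompCycle2B.LowModeLanding` (junction recording that ReynoldsLanding refines 2B's item 26915).
Pure logic (composition of the pieces / modus ponens); no facts asserted.
Source: decomp-ad cell (lens-5 ReynoldsLanding node closes / writer sketch refines_26915); landed by the cell's prover seat.  Nothing here proves the summit.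
-/

set_option linter.dupNamespace false

namespace Summit.AnomalousDissipation.AnomalousDissipation.Theorems.CellGlue

open Summit.AnomalousDissipation.AnomalousDissipation.Theses
open Summit.AnomalousDissipation.AnomalousDissipation.Theses.ReynoldsLanding

/-- GLUE item 30924 `LowModeLandingJunctionGlue` by name (composition of the filed pieces). [folklore] -/
theorem lowModeLandingJunctionGlue_holds : ReynoldsLanding.LowModeLandingJunctionGlue :=
  fun h₁ h₂ h₃ hA => h₃ (h₂ (h₁ hA))

end Summit.AnomalousDissipation.AnomalousDissipation.Theorems.CellGlue
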